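import Mathlib
import Summits.AtomisticToContinuum.FouriersLaw.Theorems.BondHeatUncertaintyPositiveOrInfiniteLimit
import Summits.AtomisticToContinuum.FouriersLaw.Theses.OddSectorIrreversibility
import Summits.AtomisticToContinuum.FouriersLaw.Theses.JunctionLocality
import Summits.AtomisticToContinuum.FouriersLaw.Theses.BoundaryEscapeDeficit
import Summits.AtomisticToContinuum.FouriersLaw.Theses.BondHeatUncertainty
import Summits.AtomisticToContinuum.FouriersLaw.Theses.FeketeSeriesLaw
import Summits.AtomisticToContinuum.FouriersLaw.Theorems.BondHeatUncertaintyPositiveOrInfiniteLimitSplit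
import Summits.AtomisticToContinuum.FouriersLaw.Theorems.BondHeatUncertaintyPositiveOrInfiniteLimitSlots
import Summits.AtomisticToContinuum.FouriersLaw.Theorems.JunctionLocalitySuperadditiveResistanceStubLinearResponsePlain
import Summits.AtomisticToContinuum.FouriersLaw.Theorems.OddSectorIrreversibilityBoundedResponseConvergesStubPositiveConductance


/-!
# Crux `BoundedResponseConverges` (stmt-AtomisticToContinuum-9141), line `escape-deficit-dichotomy` —
# Fekete with a SUMMABLE defect, part 1: block estimates (pure real analysis)

Support file for item `stmt-AtomisticToContinuum-9141`
(`Summit.AtomisticToContinuum.FouriersLaw.Theses.OddSectorIrreversibility.BoundedResponseConverges`). The series-law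
suppliers of the crux and of its two stubs (`EscapeNonOscillation` 12238, `ConductanceLowerBound` 11749) landed so far
require a BOUNDED junction defect (`R (N+M) ≤ R N + R M + C`, 14041; `R N + R M − C ≤ R (N+M)`, 11748). The companion
files `…SummableDefectFekete.lean` / `…SummableDefectSeriesLaw.lean` relax this to any defect `φ (N+M)` with `φ ≥ 0`
non-decreasing and `∑ₖ φ(2ᵏ)/2ᵏ < ∞` (de Bruijn–Erdős form of Fekete's lemma). This part holds the elementary block
estimates for a real sequence `b` with `b (n+m) ≤ b n + b m + φ (n+m)` on the index semigroup `{n, m ≥ 2}`: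

* `dyadic_div_le_of_defect_subadditive` — `b (2ⁱm)/(2ⁱm) ≤ b m / m + Σ_{l<i} φ(2^{l+1}m)/(2^{l+1}m)`;
* `mul_le_of_defect_subadditive` — all multiples `q m`, `q < 2ᵏ`, by induction on the binary length of `q`
  (each new top bit costs one defect `φ (2^{k+1} m)`);
* `mul_div_le_of_defect_subadditive` — `b (q m)/(q m) ≤ b m / m + 3τ` when `τ` bounds the dyadic partial sums;
* `div_le_of_defect_subadditive` — general `n` by Euclidean division: `b n / n ≤ b m / m + 3τ + C/n + φ n / n`
  for `n ≥ m + 2` (the registered helper sub-goal of this file).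

References: M. Fekete, Math. Z. 17 (1923) 228–249; N. G. de Bruijn and P. Erdős, *Some linear and some quadratic
recursion formulas II*, Indag. Math. 14 (1952) 152–163 (Thm. 22–23: subadditivity with an error term `φ`,
`∑ φ(n)/n² < ∞`).
-/

noncomputable section

namespace Summit.AtomisticToContinuum.FouriersLaw.Theorems.EscapeDeficitDichotomy

open Filter Topology Set

/-! ## Fekete's lemma with a summable defect (de Bruijn–Erdős) on the index semigroup `{n ≥ 2}` -/

/-- Dyadic blocks: if `b (n+m) ≤ b n + b m + φ (n+m)` on `{n, m ≥ 2}` then for `m ≥ 2` and every `i`,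
`b (2ⁱ m) / (2ⁱ m) ≤ b m / m + Σ_{l < i} φ (2^{l+1} m) / (2^{l+1} m)` (induction on `i`). [folklore] -/
theorem dyadic_div_le_of_defect_subadditive {b φ : ℕ → ℝ}
    (hb : ∀ n m : ℕ, 2 ≤ n → 2 ≤ m → b (n + m) ≤ b n + b m + φ (n + m)) {m : ℕ} (hm : 2 ≤ m) (i : ℕ) :
    b (2 ^ i * m) / ((2 ^ i * m : ℕ) : ℝ) ≤
      b m / (m : ℝ) + ∑ l ∈ Finset.range i, φ (2 ^ (l + 1) * m) / ((2 ^ (l + 1) * m : ℕ) : ℝ) := by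
  induction i with
  | zero => simp
  | succ i ih =>
    have h2i : 2 ≤ 2 ^ i * m := le_trans hm (Nat.le_mul_of_pos_left m (Nat.two_pow_pos i))
    have hstep : b (2 ^ (i + 1) * m) ≤ 2 * b (2 ^ i * m) + φ (2 ^ (i + 1) * m) := by
      have h := hb (2 ^ i * m) (2 ^ i * m) h2i h2i
      have heq : 2 ^ i * m + 2 ^ i * m = 2 ^ (i + 1) * m := by ring
      rw [heq] at h
      linarith
    have hpos : (0 : ℝ) < ((2 ^ i * m : ℕ) : ℝ) := by exact_mod_cast (show 0 < 2 ^ i * m by omega)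
    have hcast : ((2 ^ (i + 1) * m : ℕ) : ℝ) = 2 * ((2 ^ i * m : ℕ) : ℝ) := by push_cast; ring
    rw [Finset.sum_range_succ, hcast]
    have hdiv : b (2 ^ (i + 1) * m) / (2 * ((2 ^ i * m : ℕ) : ℝ)) ≤
        b (2 ^ i * m) / ((2 ^ i * m : ℕ) : ℝ) + φ (2 ^ (i + 1) * m) / (2 * ((2 ^ i * m : ℕ) : ℝ)) := by
      rw [div_add_div _ _ hpos.ne' (by positivity), div_le_div_iff₀ (by positivity) (by positivity)]
      have := mul_le_mul_of_nonneg_right hstep (show (0 : ℝ) ≤ ((2 ^ i * m : ℕ) : ℝ) from hpos.le)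
      nlinarith [this, hpos]
    linarith [hdiv, ih]

/-- All multiples, by induction on the binary length of the multiplier: if `τ` bounds every partial sum
`Σ_{l < i} φ (2^{l+1} m) / (2^{l+1} m)` and `φ ≥ 0` is non-decreasing, then for `1 ≤ q < 2ᵏ`,
`b (q m) ≤ q m · (b m / m + τ) + Σ_{l < k} φ (2^{l+1} m)` (each new top bit of `q` costs one defect).
[folklore] -/
theorem mul_le_of_defect_subadditive {b φ : ℕ → ℝ} (hφ0 : ∀ n, 0 ≤ φ n) (hφm : Monotone φ)
    (hb : ∀ n m : ℕ, 2 ≤ n → 2 ≤ m → b (n + m) ≤ b n + b m + φ (n + m)) {m : ℕ} (hm : 2 ≤ m) {τ : ℝ}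
    (hτ : ∀ i : ℕ, ∑ l ∈ Finset.range i, φ (2 ^ (l + 1) * m) / ((2 ^ (l + 1) * m : ℕ) : ℝ) ≤ τ) (k : ℕ) :
    ∀ q : ℕ, 1 ≤ q → q < 2 ^ k →
      b (q * m) ≤ ((q * m : ℕ) : ℝ) * (b m / (m : ℝ) + τ) + ∑ l ∈ Finset.range k, φ (2 ^ (l + 1) * m) := by
  -- dyadic blocks are bounded by `2ⁱ m · (b m / m + τ)`
  have hblock : ∀ i : ℕ, b (2 ^ i * m) ≤ ((2 ^ i * m : ℕ) : ℝ) * (b m / (m : ℝ) + τ) := by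
    intro i
    have hpos : (0 : ℝ) < ((2 ^ i * m : ℕ) : ℝ) := by exact_mod_cast (show 0 < 2 ^ i * m by positivity)
    have h : b (2 ^ i * m) / ((2 ^ i * m : ℕ) : ℝ) ≤ b m / (m : ℝ) + τ := by
      linarith [dyadic_div_le_of_defect_subadditive hb hm i, hτ i]
    have h' := (div_le_iff₀ hpos).1 h
    linarith [h']
  induction k with
  | zero => intro q hq hq'; simp at hq'; omega
  | succ k ih =>
    intro q hq hqk
    have hsum_mono : ∑ l ∈ Finset.range k, φ (2 ^ (l + 1) * m) ≤
        ∑ l ∈ Finset.range (k + 1), φ (2 ^ (l + 1) * m) := by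
      rw [Finset.sum_range_succ]
      linarith [hφ0 (2 ^ (k + 1) * m)]
    by_cases hlt : q < 2 ^ k
    · linarith [ih q hq hlt, hsum_mono]
    · push Not at hlt
      -- `q = 2^k + q'` with `q' < 2^k`
      obtain ⟨q', rfl⟩ : ∃ q', q = 2 ^ k + q' := ⟨q - 2 ^ k, by omega⟩
      have hq'lt : q' < 2 ^ k := by
        have : (2 : ℕ) ^ (k + 1) = 2 ^ k + 2 ^ k := by ring
        omega
      rcases Nat.eq_zero_or_pos q' with rfl | hq'pos
      · -- a pure dyadic block
        simp only [add_zero]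
        have h := hblock k
        have hnn : (0 : ℝ) ≤ ∑ l ∈ Finset.range (k + 1), φ (2 ^ (l + 1) * m) :=
          Finset.sum_nonneg fun l _ => hφ0 _
        linarith
      · have h2k : 2 ≤ 2 ^ k * m := le_trans hm (Nat.le_mul_of_pos_left m (Nat.two_pow_pos k))
        have hq'm : 2 ≤ q' * m := le_trans hm (Nat.le_mul_of_pos_left m hq'pos)
        have hsplit : (2 ^ k + q') * m = q' * m + 2 ^ k * m := by ring
        have hmain := hb (q' * m) (2 ^ k * m) hq'm h2k
        rw [← hsplit] at hmain
        -- the defect of the top merge: `φ (q m) ≤ φ (2^{k+1} m)`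
        have hφtop : φ ((2 ^ k + q') * m) ≤ φ (2 ^ (k + 1) * m) := by
          apply hφm
          have : 2 ^ k + q' ≤ 2 ^ (k + 1) := by
            have : (2 : ℕ) ^ (k + 1) = 2 ^ k + 2 ^ k := by ring
            omega
          exact Nat.mul_le_mul_right m this
        have hih := ih q' hq'pos hq'lt
        have hbk := hblock k
        have hcast : (((2 ^ k + q') * m : ℕ) : ℝ) = ((q' * m : ℕ) : ℝ) + ((2 ^ k * m : ℕ) : ℝ) := by
          push_cast; ring
        rw [hcast, Finset.sum_range_succ]
        nlinarith [hmain, hφtop, hih, hbk]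

/-- Ratio form for all multiples: under the hypotheses of `mul_le_of_defect_subadditive`,
`b (q m) / (q m) ≤ b m / m + 3 τ` for every `q ≥ 1` (the accumulated top-bit defects are at most `2 τ · q m`).
[folklore] -/
theorem mul_div_le_of_defect_subadditive {b φ : ℕ → ℝ} (hφ0 : ∀ n, 0 ≤ φ n) (hφm : Monotone φ)
    (hb : ∀ n m : ℕ, 2 ≤ n → 2 ≤ m → b (n + m) ≤ b n + b m + φ (n + m)) {m : ℕ} (hm : 2 ≤ m) {τ : ℝ}
    (hτ : ∀ i : ℕ, ∑ l ∈ Finset.range i, φ (2 ^ (l + 1) * m) / ((2 ^ (l + 1) * m : ℕ) : ℝ) ≤ τ)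
    {q : ℕ} (hq : 1 ≤ q) :
    b (q * m) / ((q * m : ℕ) : ℝ) ≤ b m / (m : ℝ) + 3 * τ := by
  -- binary length of `q`: `2^K ≤ q < 2^(K+1)`
  set K := Nat.log 2 q with hK
  have hqK : q < 2 ^ (K + 1) := Nat.lt_pow_succ_log_self (by norm_num) q
  have hKq : 2 ^ K ≤ q := Nat.pow_log_le_self 2 (by omega)
  have hmain := mul_le_of_defect_subadditive hφ0 hφm hb hm hτ (K + 1) q hq hqK
  have hqm_pos : (0 : ℝ) < ((q * m : ℕ) : ℝ) := by exact_mod_cast (show 0 < q * m by positivity)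
  -- the accumulated defects: `Σ_{l ≤ K} φ(2^{l+1} m) ≤ 2^{K+1} m · τ ≤ 2 q m τ`
  have hdef : ∑ l ∈ Finset.range (K + 1), φ (2 ^ (l + 1) * m) ≤ 2 * ((q * m : ℕ) : ℝ) * τ := by
    have hterm : ∀ l ∈ Finset.range (K + 1), φ (2 ^ (l + 1) * m) ≤
        ((2 ^ (K + 1) * m : ℕ) : ℝ) * (φ (2 ^ (l + 1) * m) / ((2 ^ (l + 1) * m : ℕ) : ℝ)) := by
      intro l hl
      have hl' : l + 1 ≤ K + 1 := by
        have := Finset.mem_range.1 hl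
        omega
      have hden_pos : (0 : ℝ) < ((2 ^ (l + 1) * m : ℕ) : ℝ) := by
        exact_mod_cast (show 0 < 2 ^ (l + 1) * m by positivity)
      have hden_le : ((2 ^ (l + 1) * m : ℕ) : ℝ) ≤ ((2 ^ (K + 1) * m : ℕ) : ℝ) := by
        exact_mod_cast Nat.mul_le_mul_right m (Nat.pow_le_pow_right (by norm_num) hl')
      rw [mul_div_assoc']
      rw [le_div_iff₀ hden_pos]
      exact mul_le_mul_of_nonneg_left hden_le (hφ0 _) |>.trans_eq (by ring)
    calc ∑ l ∈ Finset.range (K + 1), φ (2 ^ (l + 1) * m)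
        ≤ ∑ l ∈ Finset.range (K + 1),
            ((2 ^ (K + 1) * m : ℕ) : ℝ) * (φ (2 ^ (l + 1) * m) / ((2 ^ (l + 1) * m : ℕ) : ℝ)) :=
          Finset.sum_le_sum hterm
      _ = ((2 ^ (K + 1) * m : ℕ) : ℝ) *
            ∑ l ∈ Finset.range (K + 1), φ (2 ^ (l + 1) * m) / ((2 ^ (l + 1) * m : ℕ) : ℝ) := by
          rw [Finset.mul_sum]
      _ ≤ ((2 ^ (K + 1) * m : ℕ) : ℝ) * τ :=
          mul_le_mul_of_nonneg_left (hτ (K + 1)) (Nat.cast_nonneg _)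
      _ ≤ 2 * ((q * m : ℕ) : ℝ) * τ := by
          have hτ0 : 0 ≤ τ := le_trans (by simp) (hτ 0)
          have : ((2 ^ (K + 1) * m : ℕ) : ℝ) ≤ 2 * ((q * m : ℕ) : ℝ) := by
            have h : 2 ^ (K + 1) * m ≤ 2 * (q * m) := by
              have : 2 ^ (K + 1) = 2 * 2 ^ K := by ring
              rw [this, mul_assoc]
              exact Nat.mul_le_mul_left 2 (Nat.mul_le_mul_right m hKq)
            exact_mod_cast h
          exact mul_le_mul_of_nonneg_right this hτ0
  rw [div_le_iff₀ hqm_pos]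
  nlinarith [hmain, hdef, hqm_pos]

/-- General lengths by Euclidean division (`n = q m + r`, `2 ≤ r ≤ m + 1`): under the hypotheses of
`mul_le_of_defect_subadditive` there is a constant `C` (depending on `m`) with
`b n / n ≤ b m / m + 3 τ + C / n + φ n / n` for all `n ≥ m + 2`. [folklore] -/
theorem div_le_of_defect_subadditive : ∀ (b φ : ℕ → ℝ), (∀ n : ℕ, 0 ≤ φ n) → Monotone φ → (∀ n m : ℕ, 2 ≤ n → 2 ≤ m → b (n + m) ≤ b n + b m + φ (n + m)) → ∀ (m : ℕ), 2 ≤ m → ∀ (τ : ℝ), (∀ i : ℕ, (Finset.range i).sum (fun l => φ (2 ^ (l + 1) * m) / ((2 ^ (l + 1) * m : ℕ) : ℝ)) ≤ τ) → ∃ C : ℝ, ∀ n : ℕ, m + 2 ≤ n → b n / (n : ℝ) ≤ b m / (m : ℝ) + 3 * τ + C / (n : ℝ) + φ n / (n : ℝ) := by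
  intro b φ hφ0 hφm hb m hm τ hτ
  set A : ℝ := b m / (m : ℝ) + 3 * τ with hA_def
  set Kb : ℝ := ∑ r ∈ Finset.range (m + 2), |b r| with hKb_def
  have hKb : ∀ r : ℕ, r < m + 2 → b r ≤ Kb := fun r hr =>
    (le_abs_self _).trans
      (Finset.single_le_sum (f := fun i => |b i|) (fun i _ => abs_nonneg (b i)) (Finset.mem_range.2 hr))
  refine ⟨((m : ℝ) + 2) * |A| + Kb, fun n hn => ?_⟩
  have hm0 : 0 < m := by omega
  have hnpos : (0 : ℝ) < n := by exact_mod_cast (show 0 < n by omega)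
  -- Euclidean division of `n - 2` by `m`
  set q := (n - 2) / m with hq_def
  set r := (n - 2) % m + 2 with hr_def
  have hq1 : 1 ≤ q := (Nat.le_div_iff_mul_le hm0).2 (by omega)
  have hr2 : 2 ≤ r := by omega
  have hrm : r < m + 2 := by
    have := Nat.mod_lt (n - 2) hm0
    omega
  have hn_eq : n = q * m + r := by
    have := Nat.div_add_mod (n - 2) m
    simp only [hq_def, hr_def]
    rw [mul_comm]
    omega
  have hqm2 : 2 ≤ q * m := le_trans hm (Nat.le_mul_of_pos_left m hq1)
  -- split off the remainder
  have hsplit : b n ≤ b (q * m) + b r + φ n := by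
    have h := hb (q * m) r hqm2 hr2
    rwa [← hn_eq] at h
  have hmul := mul_div_le_of_defect_subadditive hφ0 hφm hb hm hτ hq1
  have hqm_pos : (0 : ℝ) < ((q * m : ℕ) : ℝ) := by exact_mod_cast (show 0 < q * m by omega)
  have hmul' : b (q * m) ≤ ((q * m : ℕ) : ℝ) * A := by
    have h := (div_le_iff₀ hqm_pos).1 hmul
    linarith [h]
  -- `(q m) · A ≤ n · A + (m + 2) |A|` since `0 ≤ n - q m = r ≤ m + 1`
  have hqm_le : ((q * m : ℕ) : ℝ) ≤ (n : ℝ) := by exact_mod_cast (show q * m ≤ n by omega)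
  have hdiff : (n : ℝ) - ((q * m : ℕ) : ℝ) ≤ (m : ℝ) + 2 := by
    have : n - q * m ≤ m + 2 := by omega
    have h' : ((n - q * m : ℕ) : ℝ) ≤ ((m + 2 : ℕ) : ℝ) := by exact_mod_cast this
    rw [Nat.cast_sub (show q * m ≤ n by omega)] at h'
    push_cast at h' ⊢
    linarith
  have hqa : ((q * m : ℕ) : ℝ) * A ≤ (n : ℝ) * A + ((m : ℝ) + 2) * |A| := by
    have hd0 : 0 ≤ (n : ℝ) - ((q * m : ℕ) : ℝ) := by linarith [hqm_le]
    have h1 : -(((n : ℝ) - ((q * m : ℕ) : ℝ)) * A) ≤ ((n : ℝ) - ((q * m : ℕ) : ℝ)) * |A| := by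
      nlinarith [mul_nonneg hd0 (show 0 ≤ A + |A| by linarith [neg_abs_le A])]
    have h2 : ((n : ℝ) - ((q * m : ℕ) : ℝ)) * |A| ≤ ((m : ℝ) + 2) * |A| :=
      mul_le_mul_of_nonneg_right hdiff (abs_nonneg A)
    nlinarith [h1, h2]
  have key : b n ≤ (n : ℝ) * A + (((m : ℝ) + 2) * |A| + Kb) + φ n := by
    linarith [hsplit, hmul', hqa, hKb r hrm]
  calc b n / (n : ℝ) ≤ ((n : ℝ) * A + (((m : ℝ) + 2) * |A| + Kb) + φ n) / (n : ℝ) :=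
        div_le_div_of_nonneg_right key hnpos.le
    _ = A + (((m : ℝ) + 2) * |A| + Kb) / (n : ℝ) + φ n / (n : ℝ) := by
        field_simp
    _ = b m / (m : ℝ) + 3 * τ + (((m : ℝ) + 2) * |A| + Kb) / (n : ℝ) + φ n / (n : ℝ) := by
        rw [hA_def]


end Summit.AtomisticToContinuum.FouriersLaw.Theorems.EscapeDeficitDichotomy

end



/-!
# Crux `BoundedResponseConverges` (stmt-AtomisticToContinuum-9141), line `escape-deficit-dichotomy` —
# Fekete with a SUMMABLE defect, part 2: the `EReal` limit and the resistance corollaries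

Support file for item `stmt-AtomisticToContinuum-9141`. Continues `…SummableDefectFeketeBlocks.lean`:

* `tendsto_div_nat_of_summable_dyadic` — `φ ≥ 0` non-decreasing with `∑ₖ φ(2ᵏ)/2ᵏ < ∞` forces `φ n / n → 0`;
* `dyadic_partial_sums_small` — the dyadic partial sums `Σ_{l<i} φ(2^{l+1}m)/(2^{l+1}m)` are uniformly `≤ ε`
  for all large bases `m`;
* `ereal_tendsto_div_of_summableDefect_subadditive` — **Fekete's lemma with a summable defect (de Bruijn–Erdős form)
  on `{n ≥ 2}`**: `b (n+m) ≤ b n + b m + φ (n+m)` ⇒ `↑(b n / n)` converges in `EReal` to a limit `< ⊤` (real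
  limit or `−∞`; no lower bound assumed) — the registered helper sub-goal of this file;
* `ereal_tendsto_of_summableDefect_subadditive_resistance` — `D N > 0` (`N ≥ 2`),
  `R (N+M) ≤ R N + R M + φ (N+M)` for `R N = (N−1)/D N` ⇒ `↑(D N) → ℓ' ∈ (0, ⊤]` (bounded-defect case: the landed
  `ereal_tendsto_of_quasiSubadditive_resistance`);
* `ereal_tendsto_of_summableDefect_superadditive_resistance` — `R N + R M − φ (N+M) ≤ R (N+M)` ⇒ `↑(D N)` converges
  in `EReal` (bounded-defect case: the landed `ereal_tendsto_of_superadditive_resistance`, p138689).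

The by-name consequences (slot 9128, floor 11749, the crux 9141, non-oscillation 12238) are in
`…SummableDefectSeriesLaw.lean`.

References: M. Fekete, Math. Z. 17 (1923) 228–249; N. G. de Bruijn and P. Erdős, *Some linear and some quadratic
recursion formulas II*, Indag. Math. 14 (1952) 152–163 (Thm. 22–23: subadditivity with an error term `φ`,
`∑ φ(n)/n² < ∞`).
-/

noncomputable section

namespace Summit.AtomisticToContinuum.FouriersLaw.Theorems.EscapeDeficitDichotomy

open Filter Topology Set
open Summit.AtomisticToContinuum.FouriersLaw.Theorems.PositiveOrInfiniteLimit

/-! ## Fekete's lemma with a summable defect (de Bruijn–Erdős) on the index semigroup `{n ≥ 2}` -/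

/-- If `φ ≥ 0` is non-decreasing and `k ↦ φ (2ᵏ) / 2ᵏ` is summable then `φ n / n → 0`
(`φ n / n ≤ 2 · φ (2^{k+1}) / 2^{k+1}` for `2ᵏ ≤ n < 2^{k+1}`, and the terms of a summable series tend to `0`).
[folklore] -/
theorem tendsto_div_nat_of_summable_dyadic {φ : ℕ → ℝ} (hφ0 : ∀ n, 0 ≤ φ n) (hφm : Monotone φ)
    (hφs : Summable fun k : ℕ => φ (2 ^ k) / ((2 ^ k : ℕ) : ℝ)) :
    Tendsto (fun n : ℕ => φ n / (n : ℝ)) atTop (𝓝 0) := by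
  have hc := hφs.tendsto_atTop_zero
  rw [Metric.tendsto_atTop] at hc ⊢
  intro ε hε
  obtain ⟨K, hK⟩ := hc (ε / 2) (half_pos hε)
  refine ⟨2 ^ K, fun n hn => ?_⟩
  have hn0 : 0 < n := lt_of_lt_of_le (Nat.two_pow_pos K) hn
  set k := Nat.log 2 n with hk
  have hnk : n < 2 ^ (k + 1) := Nat.lt_pow_succ_log_self (by norm_num) n
  have hkn : 2 ^ k ≤ n := Nat.pow_log_le_self 2 (by omega)
  have hKk : K ≤ k + 1 := by
    have : K ≤ k := by
      rw [hk]
      exact Nat.le_log_of_pow_le (by norm_num) hn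
    omega
  have hterm := hK (k + 1) hKk
  rw [Real.dist_eq, sub_zero] at hterm ⊢
  have hnpos : (0 : ℝ) < n := by exact_mod_cast hn0
  have hpow_pos : (0 : ℝ) < ((2 ^ (k + 1) : ℕ) : ℝ) := by exact_mod_cast Nat.two_pow_pos (k + 1)
  rw [abs_of_nonneg (div_nonneg (hφ0 n) hnpos.le)]
  rw [abs_of_nonneg (div_nonneg (hφ0 _) hpow_pos.le)] at hterm
  -- `φ n / n ≤ φ (2^{k+1}) / 2^k = 2 · (φ (2^{k+1}) / 2^{k+1})`
  have h1 : φ n ≤ φ (2 ^ (k + 1)) := hφm hnk.le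
  have h2 : ((2 ^ (k + 1) : ℕ) : ℝ) ≤ 2 * (n : ℝ) := by
    have : 2 ^ (k + 1) ≤ 2 * n := by
      have : 2 ^ (k + 1) = 2 * 2 ^ k := by ring
      omega
    exact_mod_cast this
  calc φ n / (n : ℝ) ≤ φ (2 ^ (k + 1)) / (n : ℝ) := div_le_div_of_nonneg_right h1 hnpos.le
    _ ≤ φ (2 ^ (k + 1)) / (((2 ^ (k + 1) : ℕ) : ℝ) / 2) := by
        apply div_le_div_of_nonneg_left (hφ0 _) (by positivity)
        linarith
    _ = 2 * (φ (2 ^ (k + 1)) / ((2 ^ (k + 1) : ℕ) : ℝ)) := by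
        field_simp
    _ < ε := by linarith

/-- The dyadic tails are uniformly small at large base: if `φ ≥ 0` is non-decreasing and `k ↦ φ (2ᵏ) / 2ᵏ` is
summable, then for every `ε > 0` there is `M` such that for all `m ≥ M` and all `i`,
`Σ_{l < i} φ (2^{l+1} m) / (2^{l+1} m) ≤ ε` (compare with twice the tail of the dyadic series beyond `log₂ m`).
[folklore] -/
theorem dyadic_partial_sums_small {φ : ℕ → ℝ} (hφ0 : ∀ n, 0 ≤ φ n) (hφm : Monotone φ)
    (hφs : Summable fun k : ℕ => φ (2 ^ k) / ((2 ^ k : ℕ) : ℝ)) {ε : ℝ} (hε : 0 < ε) :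
    ∃ M : ℕ, 2 ≤ M ∧ ∀ m : ℕ, M ≤ m → ∀ i : ℕ,
      ∑ l ∈ Finset.range i, φ (2 ^ (l + 1) * m) / ((2 ^ (l + 1) * m : ℕ) : ℝ) ≤ ε := by
  set c : ℕ → ℝ := fun k => φ (2 ^ k) / ((2 ^ k : ℕ) : ℝ) with hc_def
  have hc0 : ∀ k, 0 ≤ c k := fun k => div_nonneg (hφ0 _) (Nat.cast_nonneg _)
  -- tails of the dyadic series tend to `0`
  have htail : Tendsto (fun a : ℕ => ∑' k, c (k + a)) atTop (𝓝 0) := tendsto_sum_nat_add c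
  rw [Metric.tendsto_atTop] at htail
  obtain ⟨A₀, hA₀⟩ := htail (ε / 2) (half_pos hε)
  refine ⟨2 ^ (A₀ + 1), le_trans (by norm_num) (Nat.pow_le_pow_right (by norm_num) (Nat.succ_le_succ (Nat.zero_le _))),
    fun m hm i => ?_⟩
  have hm0 : 0 < m := lt_of_lt_of_le (Nat.two_pow_pos _) hm
  set a := Nat.log 2 m with ha
  have hma : m < 2 ^ (a + 1) := Nat.lt_pow_succ_log_self (by norm_num) m
  have ham : 2 ^ a ≤ m := Nat.pow_log_le_self 2 (by omega)
  have hA₀a : A₀ ≤ a + 2 := by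
    have : A₀ + 1 ≤ a := by
      rw [ha]
      exact Nat.le_log_of_pow_le (by norm_num) hm
    omega
  -- termwise comparison with the shifted dyadic series
  have hterm : ∀ l : ℕ, φ (2 ^ (l + 1) * m) / ((2 ^ (l + 1) * m : ℕ) : ℝ) ≤ 2 * c (l + (a + 2)) := by
    intro l
    have hnum : φ (2 ^ (l + 1) * m) ≤ φ (2 ^ (l + (a + 2))) := by
      apply hφm
      calc 2 ^ (l + 1) * m ≤ 2 ^ (l + 1) * 2 ^ (a + 1) := Nat.mul_le_mul_left _ hma.le
        _ = 2 ^ (l + (a + 2)) := by ring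
    have hden : ((2 ^ (l + (a + 2)) : ℕ) : ℝ) ≤ 2 * ((2 ^ (l + 1) * m : ℕ) : ℝ) := by
      have : 2 ^ (l + (a + 2)) ≤ 2 * (2 ^ (l + 1) * m) := by
        calc 2 ^ (l + (a + 2)) = 2 * (2 ^ (l + 1) * 2 ^ a) := by ring
          _ ≤ 2 * (2 ^ (l + 1) * m) := Nat.mul_le_mul_left 2 (Nat.mul_le_mul_left _ ham)
      exact_mod_cast this
    have hden_pos : (0 : ℝ) < ((2 ^ (l + 1) * m : ℕ) : ℝ) := by
      exact_mod_cast (show 0 < 2 ^ (l + 1) * m by positivity)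
    have hpow_pos : (0 : ℝ) < ((2 ^ (l + (a + 2)) : ℕ) : ℝ) := by exact_mod_cast Nat.two_pow_pos _
    simp only [hc_def]
    calc φ (2 ^ (l + 1) * m) / ((2 ^ (l + 1) * m : ℕ) : ℝ)
        ≤ φ (2 ^ (l + (a + 2))) / ((2 ^ (l + 1) * m : ℕ) : ℝ) := div_le_div_of_nonneg_right hnum hden_pos.le
      _ ≤ φ (2 ^ (l + (a + 2))) / (((2 ^ (l + (a + 2)) : ℕ) : ℝ) / 2) := by
          apply div_le_div_of_nonneg_left (hφ0 _) (by positivity)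
          linarith
      _ = 2 * (φ (2 ^ (l + (a + 2))) / ((2 ^ (l + (a + 2)) : ℕ) : ℝ)) := by
          field_simp
  have hsum_shift : Summable fun l : ℕ => c (l + (a + 2)) := (summable_nat_add_iff (a + 2)).2 hφs
  calc ∑ l ∈ Finset.range i, φ (2 ^ (l + 1) * m) / ((2 ^ (l + 1) * m : ℕ) : ℝ)
      ≤ ∑ l ∈ Finset.range i, 2 * c (l + (a + 2)) := Finset.sum_le_sum fun l _ => hterm l
    _ = 2 * ∑ l ∈ Finset.range i, c (l + (a + 2)) := by rw [Finset.mul_sum]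
    _ ≤ 2 * ∑' l, c (l + (a + 2)) := by
        refine mul_le_mul_of_nonneg_left ?_ (by norm_num)
        exact hsum_shift.sum_le_tsum (Finset.range i) (fun l _ => hc0 _)
    _ ≤ 2 * (ε / 2) := by
        refine mul_le_mul_of_nonneg_left ?_ (by norm_num)
        have h := hA₀ (a + 2) hA₀a
        rw [Real.dist_eq, sub_zero, abs_of_nonneg (tsum_nonneg fun l => hc0 _)] at h
        exact h.le
    _ = ε := by ring

/-- **Fekete's lemma with a summable defect (de Bruijn–Erdős form) on `{n ≥ 2}`.** If
`b (n+m) ≤ b n + b m + φ (n+m)` for all `n, m ≥ 2`, where `φ ≥ 0` is non-decreasing with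
`∑ₖ φ(2ᵏ)/2ᵏ < ∞`, then `↑(b n / n)` converges in `EReal` to a limit `ℓ < ⊤` — i.e. `b n / n` either converges
in `ℝ` or tends to `−∞` (the limit is `inf`-like; no lower bound on `b` is assumed). Proof: for every `ε > 0`
and every large base `m`, eventually `b n / n ≤ b m / m + 5ε` (`div_le_of_defect_subadditive`,
`dyadic_partial_sums_small`, `tendsto_div_nat_of_summable_dyadic`); choosing `m` along the `liminf` gives
`limsup ≤ liminf` in `EReal`. [folklore] (Fekete 1923; de Bruijn–Erdős 1952, Thm. 22–23) -/
theorem ereal_tendsto_div_of_summableDefect_subadditive : ∀ (b φ : ℕ → ℝ), (∀ n : ℕ, 0 ≤ φ n) → Monotone φ → Summable (fun k : ℕ => φ (2 ^ k) / ((2 ^ k : ℕ) : ℝ)) → (∀ n m : ℕ, 2 ≤ n → 2 ≤ m → b (n + m) ≤ b n + b m + φ (n + m)) → ∃ ℓ : EReal, ℓ < ⊤ ∧ Filter.Tendsto (fun n : ℕ => ((b n / (n : ℝ) : ℝ) : EReal)) Filter.atTop (nhds ℓ) := by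
  intro b φ hφ0 hφm hφs hb
  -- the key eventual bound: for every `ε > 0` there is `M ≥ 2` such that for every `m ≥ M`,
  -- eventually `b n / n ≤ b m / m + 5 ε`
  have key : ∀ ε : ℝ, 0 < ε → ∃ M : ℕ, 2 ≤ M ∧ ∀ m : ℕ, M ≤ m →
      ∀ᶠ n : ℕ in atTop, b n / (n : ℝ) ≤ b m / (m : ℝ) + 5 * ε := by
    intro ε hε
    obtain ⟨M, hM2, hM⟩ := dyadic_partial_sums_small hφ0 hφm hφs hε
    refine ⟨M, hM2, fun m hm => ?_⟩
    have hm2 : 2 ≤ m := hM2.trans hm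
    obtain ⟨C, hC⟩ := div_le_of_defect_subadditive b φ hφ0 hφm hb m hm2 ε (hM m hm)
    have h1 : ∀ᶠ n : ℕ in atTop, C / (n : ℝ) ≤ ε := by
      have := (tendsto_const_div_atTop_nhds_zero_nat C).eventually (ge_mem_nhds hε)
      exact this
    have h2 : ∀ᶠ n : ℕ in atTop, φ n / (n : ℝ) ≤ ε :=
      (tendsto_div_nat_of_summable_dyadic hφ0 hφm hφs).eventually (ge_mem_nhds hε)
    filter_upwards [h1, h2, eventually_ge_atTop (m + 2)] with n hn1 hn2 hn3
    linarith [hC n hn3]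
  -- `limsup ≤ liminf` for `u n := ↑(b n / n)`
  have hle : limsup (fun n : ℕ => ((b n / (n : ℝ) : ℝ) : EReal)) atTop ≤
      liminf (fun n : ℕ => ((b n / (n : ℝ) : ℝ) : EReal)) atTop := by
    by_contra hlt
    push Not at hlt
    obtain ⟨c, hc1, hc2⟩ := EReal.lt_iff_exists_real_btwn.1 hlt
    obtain ⟨d, hd1, hd2⟩ := EReal.lt_iff_exists_real_btwn.1 hc2
    have hcd : c < d := EReal.coe_lt_coe_iff.1 hd1
    obtain ⟨M, -, hM⟩ := key ((d - c) / 8) (by linarith)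
    -- a base `m ≥ M` below `c` (frequently, since `liminf < c`)
    have hfreq : ∃ᶠ m : ℕ in atTop, ((b m / (m : ℝ) : ℝ) : EReal) < (c : EReal) :=
      frequently_lt_of_liminf_lt (by isBoundedDefault) hc1
    obtain ⟨m, hmc, hmM⟩ := (hfreq.and_eventually (eventually_ge_atTop M)).exists
    have hbm : b m / (m : ℝ) < c := EReal.coe_lt_coe_iff.1 hmc
    have hev := hM m hmM
    -- hence eventually `u n < d`, contradicting `d < limsup u`
    have hev' : ∀ᶠ n : ℕ in atTop, ((b n / (n : ℝ) : ℝ) : EReal) < (d : EReal) := by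
      filter_upwards [hev] with n hn
      exact EReal.coe_lt_coe_iff.2 (by linarith)
    have hfreq' : ∃ᶠ n : ℕ in atTop, (d : EReal) < ((b n / (n : ℝ) : ℝ) : EReal) :=
      frequently_lt_of_lt_limsup (by isBoundedDefault) hd2
    obtain ⟨n, hn1, hn2⟩ := (hfreq'.and_eventually hev').exists
    exact lt_irrefl _ (hn1.trans hn2)
  have heq : liminf (fun n : ℕ => ((b n / (n : ℝ) : ℝ) : EReal)) atTop =
      limsup (fun n : ℕ => ((b n / (n : ℝ) : ℝ) : EReal)) atTop := le_antisymm liminf_le_limsup hle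
  refine ⟨limsup (fun n : ℕ => ((b n / (n : ℝ) : ℝ) : EReal)) atTop, ?_,
    tendsto_of_liminf_eq_limsup heq rfl⟩
  -- the limit is `< ⊤`: eventually `u n ≤ ↑K`
  obtain ⟨M, -, hM⟩ := key 1 one_pos
  have hev := hM M le_rfl
  have hK : limsup (fun n : ℕ => ((b n / (n : ℝ) : ℝ) : EReal)) atTop ≤
      ((b M / (M : ℝ) + 5 * 1 : ℝ) : EReal) := by
    refine limsup_le_of_le (by isBoundedDefault) ?_
    filter_upwards [hev] with n hn
    exact EReal.coe_le_coe_iff.2 hn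
  exact lt_of_le_of_lt hK (EReal.coe_lt_top _)

/-! ## Resistances with a summable junction defect -/

/-- **Subadditive series law with a summable defect ⇒ positive-or-infinite limit of the conductance.** For an
abstract sequence `D` with `D N > 0` (`N ≥ 2`) whose resistances `R N := (N−1)/D N` satisfy
`R (N+M) ≤ R N + R M + φ (N+M)` on `{N, M ≥ 2}` (`φ ≥ 0` non-decreasing, `∑ₖ φ(2ᵏ)/2ᵏ < ∞`), `↑(D N)` converges in
`EReal` to some `ℓ' > 0`: by the summable-defect Fekete lemma `R N / N → s ∈ [0, ∞)` (a REAL limit: the `EReal`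
limit is `< ⊤` and `≥ 0`), and the landed `ereal_tendsto_of_tendsto_resistance_div` concludes (`s = 0` is the
`⊤` branch). The bounded-defect case `φ ≡ C` is the landed `ereal_tendsto_of_quasiSubadditive_resistance`.
[folklore] -/
theorem ereal_tendsto_of_summableDefect_subadditive_resistance (D φ : ℕ → ℝ) (hφ0 : ∀ n, 0 ≤ φ n)
    (hφm : Monotone φ) (hφs : Summable fun k : ℕ => φ (2 ^ k) / ((2 ^ k : ℕ) : ℝ))
    (hpos : ∀ N : ℕ, 2 ≤ N → 0 < D N)
    (hsub : ∀ N M : ℕ, 2 ≤ N → 2 ≤ M →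
      ((N : ℝ) + (M : ℝ) - 1) / D (N + M) ≤ ((N : ℝ) - 1) / D N + ((M : ℝ) - 1) / D M + φ (N + M)) :
    ∃ ℓ : EReal, 0 < ℓ ∧ Tendsto (fun N : ℕ => ((D N : ℝ) : EReal)) atTop (𝓝 ℓ) := by
  set R : ℕ → ℝ := fun N => ((N : ℝ) - 1) / D N with hR_def
  have hR : ∀ n m : ℕ, 2 ≤ n → 2 ≤ m → R (n + m) ≤ R n + R m + φ (n + m) := by
    intro n m hn hm
    have h := hsub n m hn hm
    simp only [hR_def, Nat.cast_add]
    exact h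
  obtain ⟨ℓ, hℓtop, hℓ⟩ := ereal_tendsto_div_of_summableDefect_subadditive R φ hφ0 hφm hφs hR
  -- `R N / N ≥ 0` for `N ≥ 2`, so `ℓ ≥ 0` is a real number `s`
  have hRnn : ∀ N : ℕ, 2 ≤ N → 0 ≤ R N / (N : ℝ) := by
    intro N hN
    have hN1 : (0 : ℝ) ≤ (N : ℝ) - 1 := by
      have : (2 : ℝ) ≤ N := by exact_mod_cast hN
      linarith
    exact div_nonneg (div_nonneg hN1 (hpos N hN).le) (Nat.cast_nonneg N)
  have hℓ0 : (0 : EReal) ≤ ℓ :=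
    ge_of_tendsto hℓ <| by
      filter_upwards [eventually_ge_atTop 2] with N hN
      exact_mod_cast hRnn N hN
  have hℓbot : ℓ ≠ ⊥ := ne_bot_of_le_ne_bot EReal.zero_ne_bot hℓ0
  have hℓtop' : ℓ ≠ ⊤ := hℓtop.ne
  have hs : Tendsto (fun N : ℕ => R N / (N : ℝ)) atTop (𝓝 ℓ.toReal) := by
    rw [← EReal.coe_toReal hℓtop' hℓbot] at hℓ
    exact EReal.tendsto_coe.1 hℓ
  have hs0 : 0 ≤ ℓ.toReal := by
    have h := hℓ0
    rw [← EReal.coe_toReal hℓtop' hℓbot] at h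
    exact_mod_cast h
  exact ereal_tendsto_of_tendsto_resistance_div D hpos hs0 hs

/-- **Superadditive series law with a summable defect ⇒ the conductance is `EReal`-regular.** For an abstract
sequence `D` with `D N > 0` (`N ≥ 2`) and `R N + R M − φ (N+M) ≤ R (N+M)` on `{N, M ≥ 2}` (`φ ≥ 0` non-decreasing,
`∑ₖ φ(2ᵏ)/2ᵏ < ∞`), `↑(D N)` converges in `EReal` (to `0` if `R N / N → +∞`, to `1/s` or `⊤` otherwise): apply the
summable-defect Fekete lemma to the subadditive sequence `−R N`. The bounded-defect case is the landed
`ereal_tendsto_of_superadditive_resistance` (p138689). [folklore] -/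
theorem ereal_tendsto_of_summableDefect_superadditive_resistance (D φ : ℕ → ℝ) (hφ0 : ∀ n, 0 ≤ φ n)
    (hφm : Monotone φ) (hφs : Summable fun k : ℕ => φ (2 ^ k) / ((2 ^ k : ℕ) : ℝ))
    (hpos : ∀ N : ℕ, 2 ≤ N → 0 < D N)
    (hsup : ∀ N M : ℕ, 2 ≤ N → 2 ≤ M →
      ((N : ℝ) - 1) / D N + ((M : ℝ) - 1) / D M - φ (N + M) ≤ ((N : ℝ) + (M : ℝ) - 1) / D (N + M)) :
    ∃ ℓ : EReal, Tendsto (fun N : ℕ => ((D N : ℝ) : EReal)) atTop (𝓝 ℓ) := by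
  set R : ℕ → ℝ := fun N => ((N : ℝ) - 1) / D N with hR_def
  -- `u N := -R N` is defect-subadditive
  set u : ℕ → ℝ := fun N => -R N with hu_def
  have hu : ∀ n m : ℕ, 2 ≤ n → 2 ≤ m → u (n + m) ≤ u n + u m + φ (n + m) := by
    intro n m hn hm
    have h := hsup n m hn hm
    simp only [hu_def, hR_def, Nat.cast_add]
    linarith
  have hRnn : ∀ N : ℕ, 2 ≤ N → 0 ≤ R N / (N : ℝ) := by
    intro N hN
    have hN1 : (0 : ℝ) ≤ (N : ℝ) - 1 := by
      have : (2 : ℝ) ≤ N := by exact_mod_cast hN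
      linarith
    exact div_nonneg (div_nonneg hN1 (hpos N hN).le) (Nat.cast_nonneg N)
  obtain ⟨ℓ, -, hℓ⟩ := ereal_tendsto_div_of_summableDefect_subadditive u φ hφ0 hφm hφs hu
  by_cases hbot : ℓ = ⊥
  · -- `u N / N → -∞`, i.e. `R N / N → +∞`: then `D N → 0`
    rw [hbot] at hℓ
    have hRtop : Tendsto (fun N : ℕ => R N / (N : ℝ)) atTop atTop := by
      rw [tendsto_atTop]
      intro B
      have h := (EReal.tendsto_nhds_bot_iff_real.1 hℓ) (-B)
      filter_upwards [h] with N hN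
      have hN' : u N / (N : ℝ) < -B := EReal.coe_lt_coe_iff.1 hN
      simp only [hu_def, neg_div] at hN'
      linarith
    have hDle : ∀ N : ℕ, 2 ≤ N → D N ≤ (R N / (N : ℝ))⁻¹ := by
      intro N hN
      have hD := hpos N hN
      have hN1 : (0 : ℝ) < (N : ℝ) - 1 := by
        have : (2 : ℝ) ≤ N := by exact_mod_cast hN
        linarith
      have hRN : R N / (N : ℝ) = ((N : ℝ) - 1) / (D N * (N : ℝ)) := by
        simp only [hR_def]
        rw [div_div]
      rw [hRN, inv_div, le_div_iff₀ hN1]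
      nlinarith
    have hinv : Tendsto (fun N : ℕ => (R N / (N : ℝ))⁻¹) atTop (𝓝 0) := tendsto_inv_atTop_zero.comp hRtop
    have hD0 : Tendsto D atTop (𝓝 0) := by
      refine tendsto_of_tendsto_of_tendsto_of_le_of_le' tendsto_const_nhds hinv ?_ ?_
      · filter_upwards [eventually_ge_atTop 2] with N hN
        exact (hpos N hN).le
      · filter_upwards [eventually_ge_atTop 2] with N hN
        exact hDle N hN
    exact ⟨((0 : ℝ) : EReal), (continuous_coe_real_ereal.tendsto 0).comp hD0⟩
  · -- real Fekete limit `t ≤ 0` of `u N / N`: `R N / N → -t =: s ≥ 0`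
    have htop : ℓ ≠ ⊤ := by
      have h0 : ℓ ≤ (0 : EReal) :=
        le_of_tendsto hℓ <| by
          filter_upwards [eventually_ge_atTop 2] with N hN
          have : u N / (N : ℝ) ≤ 0 := by
            simp only [hu_def, neg_div]
            linarith [hRnn N hN]
          exact_mod_cast this
      exact ne_top_of_le_ne_top EReal.zero_ne_top h0
    have ht : Tendsto (fun N : ℕ => u N / (N : ℝ)) atTop (𝓝 ℓ.toReal) := by
      rw [← EReal.coe_toReal htop hbot] at hℓ
      exact EReal.tendsto_coe.1 hℓ
    have hs : Tendsto (fun N : ℕ => ((N : ℝ) - 1) / D N / (N : ℝ)) atTop (𝓝 (-ℓ.toReal)) := by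
      refine ht.neg.congr' ?_
      filter_upwards with N
      simp only [hu_def, hR_def, neg_div, neg_neg]
    have hs0 : 0 ≤ -ℓ.toReal :=
      ge_of_tendsto hs <| by
        filter_upwards [eventually_ge_atTop 2] with N hN
        exact hRnn N hN
    obtain ⟨ℓ', -, hℓ'⟩ := ereal_tendsto_of_tendsto_resistance_div D hpos hs0 hs
    exact ⟨ℓ', hℓ'⟩


end Summit.AtomisticToContinuum.FouriersLaw.Theorems.EscapeDeficitDichotomy

end



/-!
# Crux `BoundedResponseConverges` (stmt-AtomisticToContinuum-9141), line `escape-deficit-dichotomy` —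
# the series-law suppliers tolerate any SUMMABLE junction defect (by-name consequences)

Support file for item `stmt-AtomisticToContinuum-9141`
(`Summit.AtomisticToContinuum.FouriersLaw.Theses.OddSectorIrreversibility.BoundedResponseConverges`).

Every series-law supply line of this crux and of its two stubs (`EscapeNonOscillation` 12238,
`ConductanceLowerBound` 11749) landed so far asks for a BOUNDED junction defect:
`R (N+M) ≤ R N + R M + C` (`FeketeSeriesLaw.QuasiSubadditiveResistance`, 14041 ⇒ crux, p97434) or
`R N + R M − C ≤ R (N+M)` (`JunctionLocality.SuperadditiveResistance`, 11748 ⇒ 12238, p138689), `R N = (N−1)/D N`.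
With the summable-defect Fekete lemma of `…SummableDefectFekete.lean` the same conclusions hold for any defect
`φ (N+M)` with `φ ≥ 0` non-decreasing and `∑ₖ φ(2ᵏ)/2ᵏ < ∞` (equivalently `∑ φ(n)/n² < ∞`; e.g. `φ(n) = C·n^θ`,
`θ < 1`, or `C·n/(log n)²`), so that a junction / contact estimate which loses a sublinear-but-summable factor in
the length still closes the corresponding item by name. The hypotheses below are the crux's frame (parameters,
weak-NESS uniqueness, a steady-state family, `T > 0`, response coefficients `D`) followed by such a series law
(`φ` may depend on everything in the frame); positivity `D N > 0` (`N ≥ 2`) is the landed `positiveConductance_holds`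
(stmt-11750), uniqueness the landed `NessUnique_holds`, the response identity the landed `responseIdentity_proof`.

* `positiveOrInfiniteLimit_of_summableDefect_subadditive` (⇒ slot 9128),
* `conductanceLowerBound_of_summableDefect_subadditive` (⇒ stub 2 = 11749),
* `boundedResponseConverges_of_summableDefect_subadditive` (⇒ THE CRUX 9141 — registered helper sub-goal;
  generalises p97434 from a bounded to any summable junction defect),
* `escapeNonOscillation_of_responseRegular` (the canonical-family packaging, once and for all),
* `escapeNonOscillation_of_summableDefect_subadditive` / `escapeNonOscillation_of_summableDefect_superadditive`
  (⇒ stub 1 = 12238; the latter generalises p138689),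
* `boundedResponseConverges_of_quasiSubadditiveResistance'` — the constant case `φ ≡ max C 0` recovers 14041 ⇒ crux.

Nothing here closes item 9141: the summable-defect series laws are hypotheses (weaker than 14041 / 11748, which
are open). No item statement is restated or weakened; all named decls are used verbatim.
-/

noncomputable section

namespace Summit.AtomisticToContinuum.FouriersLaw.Theorems.EscapeDeficitDichotomy

open MeasureTheory Filter Topology Set
open Literature.MathematicalPhysics.KineticTheory.HeatConduction
open Summit.AtomisticToContinuum.FouriersLaw.Theses
open Summit.AtomisticToContinuum.FouriersLaw.Theorems
open Summit.AtomisticToContinuum.FouriersLaw.Theorems.PositiveOrInfiniteLimit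

/-! ## By name: summable-defect series laws ⇒ slot 9128, floor 11749, the crux 9141, non-oscillation 12238

The hypotheses below are the crux's frame (parameters, weak-NESS uniqueness, a steady-state family, `T > 0`,
response coefficients `D`) followed by a series law for `R N = (N−1)/D N` with a summable junction defect `φ`
(which may depend on everything in the frame). With `φ ≡ C` they are `FeketeSeriesLaw.QuasiSubadditiveResistance`
(14041) and `JunctionLocality.SuperadditiveResistance` (11748) respectively, so each theorem below contains the
corresponding landed bounded-defect bridge as the constant case. -/

/-- **Summable-defect SUBadditive series law ⇒ `PositiveOrInfiniteLimit`** (slot stmt-9128, by name): the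
positivity `D N > 0` (`N ≥ 2`) is the landed `positiveConductance_holds` (stmt-11750), and
`ereal_tendsto_of_summableDefect_subadditive_resistance` concludes. Generalises
`positiveOrInfiniteLimit_of_quasiSubadditiveResistance` (bounded defect). [folklore] -/
theorem positiveOrInfiniteLimit_of_summableDefect_subadditive
    (hS : ∀ ω₂ lam β γ : ℝ, 0 < ω₂ → 0 < lam → 0 < β → 0 < γ →
      (∀ (N : ℕ) (T_L T_R : ℝ), 0 < T_L → 0 < T_R →
        ∀ μ ν : MeasureTheory.Measure (PhaseSpace N),
          (pinnedChain ω₂ lam β γ).IsSteadyState N T_L T_R μ →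
          (pinnedChain ω₂ lam β γ).IsSteadyState N T_L T_R ν → μ = ν) →
      ∀ μ : (N : ℕ) → ℝ → ℝ → MeasureTheory.Measure (PhaseSpace N),
        (∀ (N : ℕ) (T_L T_R : ℝ), 0 < T_L → 0 < T_R →
          (pinnedChain ω₂ lam β γ).IsSteadyState N T_L T_R (μ N T_L T_R)) →
        ∀ T : ℝ, 0 < T → ∀ D : ℕ → ℝ,
          (∀ N : ℕ, Tendsto (fun δ : ℝ =>
              (pinnedChain ω₂ lam β γ).totalCurrent (μ N (T + δ / 2) (T - δ / 2)) / δ)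
            (𝓝[≠] 0) (𝓝 (D N))) →
          ∃ φ : ℕ → ℝ, (∀ n, 0 ≤ φ n) ∧ Monotone φ ∧
            Summable (fun k : ℕ => φ (2 ^ k) / ((2 ^ k : ℕ) : ℝ)) ∧
            ∀ N M : ℕ, 2 ≤ N → 2 ≤ M →
              ((N : ℝ) + (M : ℝ) - 1) / D (N + M) ≤ ((N : ℝ) - 1) / D N + ((M : ℝ) - 1) / D M + φ (N + M)) :
    BondHeatUncertainty.PositiveOrInfiniteLimit := by
  intro ω₂ lam β γ hω hl hβ hγ huniq μ hμ T hT D hD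
  have hpos : ∀ N : ℕ, 2 ≤ N → 0 < D N :=
    Summit.AtomisticToContinuum.FouriersLaw.Cruxes.BoundedResponseConverges.TwoScaleGluingLogRigidity.Stubs.positiveConductance_holds
      ω₂ lam β γ hω hl hβ hγ huniq μ hμ T hT D hD
  obtain ⟨φ, hφ0, hφm, hφs, hsub⟩ := hS ω₂ lam β γ hω hl hβ hγ huniq μ hμ T hT D hD
  exact ereal_tendsto_of_summableDefect_subadditive_resistance D φ hφ0 hφm hφs hpos hsub

/-- **Summable-defect subadditive series law ⇒ `ConductanceLowerBound`** (stub 2 of the line = stmt-11749, by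
name), through the landed necessity `conductanceLowerBound_of_positiveOrInfiniteLimit`. [folklore] -/
theorem conductanceLowerBound_of_summableDefect_subadditive
    (hS : ∀ ω₂ lam β γ : ℝ, 0 < ω₂ → 0 < lam → 0 < β → 0 < γ →
      (∀ (N : ℕ) (T_L T_R : ℝ), 0 < T_L → 0 < T_R →
        ∀ μ ν : MeasureTheory.Measure (PhaseSpace N),
          (pinnedChain ω₂ lam β γ).IsSteadyState N T_L T_R μ →
          (pinnedChain ω₂ lam β γ).IsSteadyState N T_L T_R ν → μ = ν) →
      ∀ μ : (N : ℕ) → ℝ → ℝ → MeasureTheory.Measure (PhaseSpace N),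
        (∀ (N : ℕ) (T_L T_R : ℝ), 0 < T_L → 0 < T_R →
          (pinnedChain ω₂ lam β γ).IsSteadyState N T_L T_R (μ N T_L T_R)) →
        ∀ T : ℝ, 0 < T → ∀ D : ℕ → ℝ,
          (∀ N : ℕ, Tendsto (fun δ : ℝ =>
              (pinnedChain ω₂ lam β γ).totalCurrent (μ N (T + δ / 2) (T - δ / 2)) / δ)
            (𝓝[≠] 0) (𝓝 (D N))) →
          ∃ φ : ℕ → ℝ, (∀ n, 0 ≤ φ n) ∧ Monotone φ ∧
            Summable (fun k : ℕ => φ (2 ^ k) / ((2 ^ k : ℕ) : ℝ)) ∧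
            ∀ N M : ℕ, 2 ≤ N → 2 ≤ M →
              ((N : ℝ) + (M : ℝ) - 1) / D (N + M) ≤ ((N : ℝ) - 1) / D N + ((M : ℝ) - 1) / D M + φ (N + M)) :
    JunctionLocality.ConductanceLowerBound :=
  conductanceLowerBound_of_positiveOrInfiniteLimit (positiveOrInfiniteLimit_of_summableDefect_subadditive hS)

/-- **Summable-defect subadditive series law ⇒ THE CRUX `OddSectorIrreversibility.BoundedResponseConverges`**
(stmt-9141, by name): the slot's `EReal` limit `ℓ > 0` is capped by the crux's own `BddAbove (range |D|)`
(landed `boundedResponseConverges_of_positiveOrInfiniteLimit`; the `LocalOhmBV` / `OddSectorIrreversibility` copies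
of the crux are the same proposition). Generalises the landed 14041-bridge
`boundedResponseConverges_of_quasiSubadditiveResistance` (p97434) from a bounded to any summable junction defect.
[folklore] -/
theorem boundedResponseConverges_of_summableDefect_subadditive : (∀ ω₂ lam β γ : ℝ, 0 < ω₂ → 0 < lam → 0 < β → 0 < γ → (∀ (N : ℕ) (T_L T_R : ℝ), 0 < T_L → 0 < T_R → ∀ μ ν : MeasureTheory.Measure (Literature.MathematicalPhysics.KineticTheory.HeatConduction.PhaseSpace N), (Literature.MathematicalPhysics.KineticTheory.HeatConduction.pinnedChain ω₂ lam β γ).IsSteadyState N T_L T_R μ → (Literature.MathematicalPhysics.KineticTheory.HeatConduction.pinnedChain ω₂ lam β γ).IsSteadyState N T_L T_R ν → μ = ν) → ∀ μ : (N : ℕ) → ℝ → ℝ → MeasureTheory.Measure (Literature.MathematicalPhysics.KineticTheory.HeatConduction.PhaseSpace N), (∀ (N : ℕ) (T_L T_R : ℝ), 0 < T_L → 0 < T_R → (Literature.MathematicalPhysics.KineticTheory.HeatConduction.pinnedChain ω₂ lam β γ).IsSteadyState N T_L T_R (μ N T_L T_R)) → ∀ T : ℝ, 0 < T → ∀ D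 : ℕ → ℝ, (∀ N : ℕ, Filter.Tendsto (fun δ : ℝ => (Literature.MathematicalPhysics.KineticTheory.HeatConduction.pinnedChain ω₂ lam β γ).totalCurrent (μ N (T + δ / 2) (T - δ / 2)) / δ) (nhdsWithin 0 {(0 : ℝ)}ᶜ) (nhds (D N))) → ∃ φ : ℕ → ℝ, (∀ n : ℕ, 0 ≤ φ n) ∧ Monotone φ ∧ Summable (fun k : ℕ => φ (2 ^ k) / ((2 ^ k : ℕ) : ℝ)) ∧ ∀ N M : ℕ, 2 ≤ N → 2 ≤ M → ((N : ℝ) + (M : ℝ) - 1) / D (N + M) ≤ ((N : ℝ) - 1) / D N + ((M : ℝ) - 1) / D M + φ (N + M)) → Summit.AtomisticToContinuum.FouriersLaw.Theses.OddSectorIrreversibility.BoundedResponseConverges :=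
  fun hS => boundedResponseConverges_of_positiveOrInfiniteLimit
    (positiveOrInfiniteLimit_of_summableDefect_subadditive hS)

/-- **`EReal`-regularity of the response along every family ⇒ `EscapeNonOscillation`** (stmt-12238, by name) — the
canonical-family packaging once and for all: along the steady-state family given by the landed existence theorem
`pinnedChain_exists_isSteadyState` (junk `0` at non-positive temperatures), the PROVED response identity
(`responseIdentity_proof`, fed with the PROVED `NessUnique_holds`) supplies response coefficients
`D N = (N−1)·γ·E_N` for `N ≥ 1` (`D 0 := 0`, `totalCurrent_zero`); an `EReal` limit of `↑(D N)` is one of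
`↑((N−1)·γ·E_N)`. (The hypothesis is the "regular" half of the landed exact split
`positiveOrInfiniteLimit_iff_conductanceLowerBound_and_regular`.) [folklore] -/
theorem escapeNonOscillation_of_responseRegular
    (hR : ∀ ω₂ lam β γ : ℝ, 0 < ω₂ → 0 < lam → 0 < β → 0 < γ →
      (∀ (N : ℕ) (T_L T_R : ℝ), 0 < T_L → 0 < T_R →
        ∀ μ ν : MeasureTheory.Measure (PhaseSpace N),
          (pinnedChain ω₂ lam β γ).IsSteadyState N T_L T_R μ →
          (pinnedChain ω₂ lam β γ).IsSteadyState N T_L T_R ν → μ = ν) →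
      ∀ μ : (N : ℕ) → ℝ → ℝ → MeasureTheory.Measure (PhaseSpace N),
        (∀ (N : ℕ) (T_L T_R : ℝ), 0 < T_L → 0 < T_R →
          (pinnedChain ω₂ lam β γ).IsSteadyState N T_L T_R (μ N T_L T_R)) →
        ∀ T : ℝ, 0 < T → ∀ D : ℕ → ℝ,
          (∀ N : ℕ, Tendsto (fun δ : ℝ =>
              (pinnedChain ω₂ lam β γ).totalCurrent (μ N (T + δ / 2) (T - δ / 2)) / δ)
            (𝓝[≠] 0) (𝓝 (D N))) →
          ∃ ℓ : EReal, Tendsto (fun N : ℕ => ((D N : ℝ) : EReal)) atTop (𝓝 ℓ)) :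
    BoundaryEscapeDeficit.EscapeNonOscillation := by
  intro ω₂ lam β γ hω hl hβ hγ T hT P K E
  classical
  have huniq := BoundaryEscapeDeficit.NessUnique_holds ω₂ lam β γ hω hl hβ hγ
  -- the canonical steady-state family
  let μ₀ : (N : ℕ) → ℝ → ℝ → MeasureTheory.Measure (PhaseSpace N) := fun N T_L T_R =>
    if h : 0 < T_L ∧ 0 < T_R then
      Classical.choose (pinnedChain_exists_isSteadyState hω hl hβ hγ N h.1 h.2) else 0
  have hμ₀ : ∀ (N : ℕ) (T_L T_R : ℝ), 0 < T_L → 0 < T_R →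
      (pinnedChain ω₂ lam β γ).IsSteadyState N T_L T_R (μ₀ N T_L T_R) := by
    intro N T_L T_R hL' hR'
    simp only [μ₀, dif_pos (And.intro hL' hR')]
    exact Classical.choose_spec (pinnedChain_exists_isSteadyState hω hl hβ hγ N hL' hR')
  have hRI :=
    Summit.AtomisticToContinuum.FouriersLaw.Cruxes.SuperadditiveResistance.ThermaliseThenCutProbeInsertion.responseIdentity_proof
      ω₂ lam β γ hω hl hβ hγ huniq μ₀ hμ₀ T hT
  -- response coefficients along μ₀: the escape expression for `N ≥ 1`, `0` for the empty chain
  let D : ℕ → ℝ := fun N => if N = 0 then 0 else ((N : ℝ) - 1) * γ * E N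
  have hD : ∀ N : ℕ, Tendsto
      (fun δ : ℝ => (pinnedChain ω₂ lam β γ).totalCurrent (μ₀ N (T + δ / 2) (T - δ / 2)) / δ)
      (𝓝[≠] 0) (𝓝 (D N)) := by
    intro N
    rcases Nat.eq_zero_or_pos N with rfl | hN
    · have hD0 : D 0 = 0 := by simp [D]
      rw [hD0]
      simp only [OscillatorChain.totalCurrent_zero, zero_div]
      exact tendsto_const_nhds
    · have hDN : D N = ((N : ℝ) - 1) * γ * E N := by simp [D, hN.ne']
      rw [hDN]
      exact (hRI N hN).2
  obtain ⟨ℓ, hℓ⟩ := hR ω₂ lam β γ hω hl hβ hγ huniq μ₀ hμ₀ T hT D hD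
  refine ⟨ℓ, hℓ.congr' ?_⟩
  filter_upwards [eventually_gt_atTop 0] with N hN
  have hDN : D N = ((N : ℝ) - 1) * γ * E N := by simp [D, hN.ne']
  rw [hDN]

/-- **Summable-defect subadditive series law ⇒ `EscapeNonOscillation`** (stub 1 of the line = stmt-12238, by name):
through the slot and the landed `escapeNonOscillation_of_positiveOrInfiniteLimit`. Generalises the registered
skeleton's map `stub_escapeNonOscillation_of_quasiSubadditiveResistance` (14041, bounded defect). [folklore] -/
theorem escapeNonOscillation_of_summableDefect_subadditive
    (hS : ∀ ω₂ lam β γ : ℝ, 0 < ω₂ → 0 < lam → 0 < β → 0 < γ →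
      (∀ (N : ℕ) (T_L T_R : ℝ), 0 < T_L → 0 < T_R →
        ∀ μ ν : MeasureTheory.Measure (PhaseSpace N),
          (pinnedChain ω₂ lam β γ).IsSteadyState N T_L T_R μ →
          (pinnedChain ω₂ lam β γ).IsSteadyState N T_L T_R ν → μ = ν) →
      ∀ μ : (N : ℕ) → ℝ → ℝ → MeasureTheory.Measure (PhaseSpace N),
        (∀ (N : ℕ) (T_L T_R : ℝ), 0 < T_L → 0 < T_R →
          (pinnedChain ω₂ lam β γ).IsSteadyState N T_L T_R (μ N T_L T_R)) →
        ∀ T : ℝ, 0 < T → ∀ D : ℕ → ℝ,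
          (∀ N : ℕ, Tendsto (fun δ : ℝ =>
              (pinnedChain ω₂ lam β γ).totalCurrent (μ N (T + δ / 2) (T - δ / 2)) / δ)
            (𝓝[≠] 0) (𝓝 (D N))) →
          ∃ φ : ℕ → ℝ, (∀ n, 0 ≤ φ n) ∧ Monotone φ ∧
            Summable (fun k : ℕ => φ (2 ^ k) / ((2 ^ k : ℕ) : ℝ)) ∧
            ∀ N M : ℕ, 2 ≤ N → 2 ≤ M →
              ((N : ℝ) + (M : ℝ) - 1) / D (N + M) ≤ ((N : ℝ) - 1) / D N + ((M : ℝ) - 1) / D M + φ (N + M)) :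
    BoundaryEscapeDeficit.EscapeNonOscillation :=
  escapeNonOscillation_of_positiveOrInfiniteLimit BoundaryEscapeDeficit.NessUnique_holds
    Summit.AtomisticToContinuum.FouriersLaw.Cruxes.SuperadditiveResistance.ThermaliseThenCutProbeInsertion.responseIdentity_proof
    (positiveOrInfiniteLimit_of_summableDefect_subadditive hS)

/-- **Summable-defect SUPERadditive series law ⇒ `EscapeNonOscillation`** (stub 1 of the line = stmt-12238, by
name): `ereal_tendsto_of_summableDefect_superadditive_resistance` gives the `EReal`-regularity of every response
sequence (positivity from the landed `positiveConductance_holds`), and `escapeNonOscillation_of_responseRegular`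
packages it. Generalises the landed 11748-bridge `escapeNonOscillation_of_superadditiveResistance` (p138689) from a
bounded to any summable junction defect. [folklore] -/
theorem escapeNonOscillation_of_summableDefect_superadditive
    (hA : ∀ ω₂ lam β γ : ℝ, 0 < ω₂ → 0 < lam → 0 < β → 0 < γ →
      (∀ (N : ℕ) (T_L T_R : ℝ), 0 < T_L → 0 < T_R →
        ∀ μ ν : MeasureTheory.Measure (PhaseSpace N),
          (pinnedChain ω₂ lam β γ).IsSteadyState N T_L T_R μ →
          (pinnedChain ω₂ lam β γ).IsSteadyState N T_L T_R ν → μ = ν) →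
      ∀ μ : (N : ℕ) → ℝ → ℝ → MeasureTheory.Measure (PhaseSpace N),
        (∀ (N : ℕ) (T_L T_R : ℝ), 0 < T_L → 0 < T_R →
          (pinnedChain ω₂ lam β γ).IsSteadyState N T_L T_R (μ N T_L T_R)) →
        ∀ T : ℝ, 0 < T → ∀ D : ℕ → ℝ,
          (∀ N : ℕ, Tendsto (fun δ : ℝ =>
              (pinnedChain ω₂ lam β γ).totalCurrent (μ N (T + δ / 2) (T - δ / 2)) / δ)
            (𝓝[≠] 0) (𝓝 (D N))) →
          ∃ φ : ℕ → ℝ, (∀ n, 0 ≤ φ n) ∧ Monotone φ ∧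
            Summable (fun k : ℕ => φ (2 ^ k) / ((2 ^ k : ℕ) : ℝ)) ∧
            ∀ N M : ℕ, 2 ≤ N → 2 ≤ M →
              ((N : ℝ) - 1) / D N + ((M : ℝ) - 1) / D M - φ (N + M) ≤ ((N : ℝ) + (M : ℝ) - 1) / D (N + M)) :
    BoundaryEscapeDeficit.EscapeNonOscillation := by
  refine escapeNonOscillation_of_responseRegular ?_
  intro ω₂ lam β γ hω hl hβ hγ huniq μ hμ T hT D hD
  have hpos : ∀ N : ℕ, 2 ≤ N → 0 < D N :=
    Summit.AtomisticToContinuum.FouriersLaw.Cruxes.BoundedResponseConverges.TwoScaleGluingLogRigidity.Stubs.positiveConductance_holds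
      ω₂ lam β γ hω hl hβ hγ huniq μ hμ T hT D hD
  obtain ⟨φ, hφ0, hφm, hφs, hsup⟩ := hA ω₂ lam β γ hω hl hβ hγ huniq μ hμ T hT D hD
  exact ereal_tendsto_of_summableDefect_superadditive_resistance D φ hφ0 hφm hφs hpos hsup

/-- **The constant case recovers the landed bridges**: `QuasiSubadditiveResistance` (14041) is the summable-defect
subadditive law with `φ ≡ max C 0` — so 14041 ⇒ the crux through this file as well (cf. p97434). [folklore] -/
theorem boundedResponseConverges_of_quasiSubadditiveResistance'
    (hS : FeketeSeriesLaw.QuasiSubadditiveResistance) : OddSectorIrreversibility.BoundedResponseConverges := by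
  refine boundedResponseConverges_of_summableDefect_subadditive ?_
  intro ω₂ lam β γ hω hl hβ hγ huniq μ hμ T hT D hD
  obtain ⟨C, hC⟩ := hS ω₂ lam β γ hω hl hβ hγ huniq μ hμ T hT D hD
  refine ⟨fun _ => max C 0, fun _ => le_max_right _ _, fun _ _ _ => le_rfl, ?_, ?_⟩
  · -- `∑ₖ max C 0 / 2ᵏ` is a convergent geometric series
    have h : Summable fun k : ℕ => max C 0 * (1 / 2 : ℝ) ^ k :=
      (summable_geometric_of_lt_one (by norm_num) (by norm_num)).mul_left (max C 0)
    refine h.congr fun k => ?_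
    rw [Nat.cast_pow, Nat.cast_ofNat, one_div, inv_pow, div_eq_mul_inv]
  · intro N M hN hM
    have h := hC N M hN hM
    have h1 : ((N + M - 1 : ℕ) : ℝ) = (N : ℝ) + (M : ℝ) - 1 := by
      rw [Nat.cast_sub (by omega), Nat.cast_add, Nat.cast_one]
    have h2 : ((N - 1 : ℕ) : ℝ) = (N : ℝ) - 1 := by
      rw [Nat.cast_sub (by omega), Nat.cast_one]
    have h3 : ((M - 1 : ℕ) : ℝ) = (M : ℝ) - 1 := by
      rw [Nat.cast_sub (by omega), Nat.cast_one]
    rw [h1, h2, h3] at h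
    linarith [le_max_left C 0]


end Summit.AtomisticToContinuum.FouriersLaw.Theorems.EscapeDeficitDichotomy

end
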